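import Mathlib.Analysis.Fourier.PoissonSummation
import Mathlib.Analysis.Distribution.SchwartzSpace.Fourier
import Mathlib.MeasureTheory.Measure.Haar.NormedSpace
import Mathlib.Topology.Algebra.Module.FiniteDimension
import HarnessLib

/-!
# The dynamical Lefschetz trace formula for the translation flow on the circle `ℝ/lℤ` is the Poisson summation formula (Deninger 2002, Thm 3.3 for `X = ℝ/lℤ`; Deninger–Singhof 2001, Thm 2.6)

The simplest foliated dynamical system of Deninger's programme: the compact oriented `1`-manifold
`X = ℝ/lℤ` (`l > 0`) with its one-codimensional foliation by points and the translation flow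
`φ^t(x) = x + t`, which is everywhere transversal to the leaves and has exactly one closed orbit,
of length `l`, non-degenerate with `ε_γ(k) = 1`. The reduced leafwise cohomology is
`H̄^0_𝓕(X) = C^∞(ℝ/lℤ)` (INFINITE-dimensional), the infinitesimal generator `Θ` of `φ^{t*}` has
spectrum `(2πi/l)ℤ` with simple eigenvalues, and the dynamical Lefschetz trace formula
[Deninger2002, Thm 3.3, eq. (12)] (Álvarez López–Kordyukov; distributional trace
`Tr(φ^* | H̄^n)(φ) := tr ∫ φ(t) φ^{t*} dt`, trace class) reads, for this `X`,

  `Σ_{ν ∈ ℤ} e^{2πiνt/l} = l · Σ_{k ∈ ℤ} δ_{kl}`   in `𝒟'(ℝ)`,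

i.e. paired with a test function `g`: `Σ_ν ∫ g(t) e^{2πiνt/l} dt = l Σ_k g(kl)` — the Poisson
summation formula. The left-hand side is Deninger's definition of the distributional trace as the
sum `Σ_{λ ∈ Sp(Θ)} e^{tλ}` over the spectrum of the generator, "a sum converging in `𝒟'(ℝ)`"
although "the sum `Σ e^{iνt}` does not converge for a single real `t`" [DeningerSinghof2001,
Thm 2.6 and the example after it, held text `book:functions2001-…` chunk p0064 L22–30];
[Deninger2002, Thm 5.9] uses the same definition `Tr(φ^* | H^n_𝓕(X)) := Σ_{λ ∈ Sp^n(Θ)} e^{tλ}`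
for the `q^ℤ`-solenoids. The right-hand side consists of the closed-orbit atoms
`l(γ) ε_γ(k) δ_{k l(γ)} = l · δ_{kl}`, `k ∈ ℤ ∖ 0`, and the `δ_0`-term `l · δ_0` of (12).

This file PROVES the identity for Schwartz test functions `g ∈ 𝓢(ℝ, ℂ)` from Mathlib's Poisson
summation formula (`SchwartzMap.tsum_eq_tsum_fourier`, applied to the rescaled function
`x ↦ g(lx)`), and isolates the atom at the period: for `g` supported in `(l/2, 3l/2)` the trace
pairs to `l · g(l)`. It is the companion "evasion" of the catalogued barrier
`Literature.Barriers.RiemannHypothesis.FiniteCarrierNoOrbitAtoms` (a FINITE-dimensional flow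
carrier has a continuous Lefschetz density and can carry no atom): here the carrier is
infinite-dimensional and the atoms appear by distributional convergence.

## Contents

* `TranslationFlow.trace l g = Σ'_{ν ∈ ℤ} ∫ g(t) e^{2πiνt/l} dt` — the distributional trace of
  `φ^*` on `C^∞(ℝ/lℤ) ⊗ ℂ` paired with `g`.
* `TranslationFlow.trace_eq_tsum`: `trace l g = l · Σ'_{k ∈ ℤ} g(kl)` (`l > 0`).
* `TranslationFlow.trace_eq_of_tsupport_subset`: `tsupport g ⊆ (l/2, 3l/2) ⇒ trace l g = l · g(l)`.
* `TranslationFlow.trace_one_eq_tsum`: `l = 1`, plain Poisson summation `Σ_ν 𝓕g(ν) = Σ_k g(k)` in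
  this reading.

## References

* [Deninger2002] C. Deninger, *Number theory and dynamical systems on foliated spaces*, Jahresber.
  DMV 103 (2001) 79–100 = arXiv:math/0204110 — §3, 3.2 and Thm 3.3 (eq. (12)); §5, Thm 5.9
  (definition of `Tr` as `Σ_{λ ∈ Sp(Θ)} e^{tλ}`). Read at page (held text `paper:arxiv-math_0204110`,
  chunks p0006, p0013).
* [DeningerSinghof2001] C. Deninger, W. Singhof, *A note on dynamical trace formulas*, in: Dynamical,
  Spectral, and Arithmetic Zeta Functions (San Antonio 1999), Contemp. Math. 290, AMS 2001, 41–55 —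
  Thm 2.6 (`Tr(ψ^* | ker Δ^i_𝓕) = Σ_α dim E_α · e^{αt}` in `𝒟'(ℝ^*)` for isometric flows) and the
  example following it (`Σ_{ν ≥ 1} e^{iνt}` converges in `𝒟'(ℝ)`, not pointwise). Read at page
  (held text `book:functions2001-dynamical-spectral-arithmetic-zeta-functions-ams-special`, chunk
  p0064).
* Poisson summation: Mathlib `SchwartzMap.tsum_eq_tsum_fourier` (Stein–Weiss VII.2.6).

## Design notes

* Test functions are Schwartz functions `𝓢(ℝ, ℂ)` (Mathlib's Poisson summation is stated for them;
  `C_c^∞ ⊂ 𝓢`). The trace is DEFINED as the `tsum` over the spectrum; no trace-class theory is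
  imported (for the circle the operator `∫ g(t) φ^{t*} dt` is diagonal in the Fourier basis with
  eigenvalues `∫ g(t) e^{2πiνt/l} dt`, so the definition is the literal trace).
* The rescaling `x ↦ lx` is implemented with `SchwartzMap.compCLMOfContinuousLinearEquiv`; the
  substitution in the Fourier integral is `MeasureTheory.Measure.integral_comp_mul_left`.
* Deliberately NOT here: leafwise cohomology / the Hodge isomorphism `H̄^0 ≅ ker Δ` (for the point
  foliation `Δ_𝓕 = 0` and `H̄^0` is all of `C^∞(X)`), Connes' Euler characteristic (the coefficient
  of `δ_0` in (12) is identified only numerically, as `l`), higher-dimensional tori / Kronecker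
  foliations, the `q^ℤ`-solenoids of [Deninger2002, §5].
-/

noncomputable section

open MeasureTheory Set Real
open scoped SchwartzMap FourierTransform

namespace Literature.Dynamics.Circle

namespace TranslationFlow

/-- Rescaling `x ↦ l x` of the line as a continuous linear automorphism (`l ≠ 0`). [folklore] -/
def scaleEquiv {l : ℝ} (hl : l ≠ 0) : ℝ ≃L[ℝ] ℝ :=
  (LinearEquiv.smulOfNeZero ℝ ℝ l hl).toContinuousLinearEquiv

/-- `scaleEquiv hl x = l * x`. [folklore] -/
@[simp] private theorem scaleEquiv_apply {l : ℝ} (hl : l ≠ 0) (x : ℝ) :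
    scaleEquiv hl x = l * x := rfl

/-- The rescaled test function `x ↦ g (l x)` as a Schwartz function (Mathlib's
`SchwartzMap.compCLMOfContinuousLinearEquiv`). [folklore] -/
def rescale {l : ℝ} (hl : l ≠ 0) (g : 𝓢(ℝ, ℂ)) : 𝓢(ℝ, ℂ) :=
  SchwartzMap.compCLMOfContinuousLinearEquiv ℂ (scaleEquiv hl) g

/-- `rescale hl g x = g (l * x)`. [folklore] -/
@[simp] private theorem rescale_apply {l : ℝ} (hl : l ≠ 0) (g : 𝓢(ℝ, ℂ)) (x : ℝ) :
    rescale hl g x = g (l * x) := by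
  simp [rescale]

/-- **The distributional trace of the translation flow on `C^∞(ℝ/lℤ)`**, paired with a test
function `g`: the infinitesimal generator `Θ` of `φ^{t*}` (`(φ^t f)(x) = f(x + t)`) on
`H̄^0 = C^∞(ℝ/lℤ) ⊗ ℂ` has spectrum `Sp(Θ) = (2πi/l)ℤ`, each eigenvalue simple (eigenfunctions
`e^{2πiνx/l}`), and following Deninger's definition `Tr(φ^* | H) := Σ_{λ ∈ Sp(Θ)} e^{tλ}` (a sum
converging in `𝒟'(ℝ)`, not pointwise) the trace pairs with `g` to `Σ_{ν ∈ ℤ} ∫ g(t) e^{2πiνt/l} dt`.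
[cite: Deninger2002, Thm 5.9] [cite: DeningerSinghof2001, Thm 2.6] -/
def trace (l : ℝ) (g : 𝓢(ℝ, ℂ)) : ℂ :=
  ∑' ν : ℤ, ∫ t : ℝ, Complex.exp (2 * π * Complex.I * ν * t / l) * g t

/-- **Dynamical Lefschetz trace formula for the circle = Poisson summation.** For the translation
flow on `X = ℝ/lℤ` (`l > 0`; the one-codimensional foliation by points is transversal to the flow,
there is exactly one closed orbit, of length `l`, with `ε_γ(k) = 1`) the distributional trace of
`φ^*` on `H̄^0` equals `l · Σ_{k ∈ ℤ} δ_{kl}`: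
`Σ_{ν ∈ ℤ} ∫ g(t) e^{2πiνt/l} dt = l · Σ_{k ∈ ℤ} g(kl)` for every Schwartz function `g` — the
right-hand side of [Deninger2002, Thm 3.3 (12)] for this `X` (the atoms `l · δ_{kl}`, `k ≠ 0`, are
the closed-orbit terms `l(γ) ε_γ(k) δ_{k l(γ)}`, and `l · δ_0` is the `δ_0`-term). The proof is
Mathlib's Poisson summation formula for Schwartz functions applied to `x ↦ g(lx)`.
[cite: Deninger2002, Thm 3.3] -/
theorem trace_eq_tsum {l : ℝ} (hl : 0 < l) (g : 𝓢(ℝ, ℂ)) :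
    trace l g = l * ∑' k : ℤ, g (k * l) := by
  have hl0 : l ≠ 0 := hl.ne'
  set f : 𝓢(ℝ, ℂ) := rescale hl0 g with hf
  -- Poisson summation for `f` at `x = 0`
  have hP := f.tsum_eq_tsum_fourier 0
  simp only [zero_add, QuotientAddGroup.mk_zero, fourier_eval_zero, mul_one] at hP
  -- the left-hand side of Poisson: `Σ_k f(k) = Σ_k g(k l)`
  have h1 : ∑' k : ℤ, (f : ℝ → ℂ) k = ∑' k : ℤ, g (k * l) :=
    tsum_congr fun k => by rw [hf, rescale_apply, mul_comm]
  -- the Fourier coefficients of `f`: `𝓕 f (n) = l⁻¹ ∫ g(t) e^{-2πi n t / l} dt`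
  have h2 : ∀ n : ℤ, (𝓕 f) (n : ℝ) =
      (l⁻¹ : ℂ) * ∫ t : ℝ, Complex.exp (-(2 * π * Complex.I * n * t / l)) * g t := by
    intro n
    have hc := congrFun (SchwartzMap.fourier_coe f) (n : ℝ)
    rw [hc, Real.fourier_real_eq_integral_exp_smul]
    have hsub := Measure.integral_comp_mul_left
      (fun t : ℝ => Complex.exp (-(2 * π * Complex.I * n * t / l)) * g t) l
    rw [abs_of_pos (inv_pos.2 hl)] at hsub
    have hint : (∫ v : ℝ, Complex.exp (↑(-2 * π * v * (n : ℝ)) * Complex.I) • (f : ℝ → ℂ) v) =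
        ∫ x : ℝ, (fun t : ℝ => Complex.exp (-(2 * π * Complex.I * n * t / l)) * g t) (l * x) := by
      refine integral_congr_ae (ae_of_all _ fun v => ?_)
      have hlC : (l : ℂ) ≠ 0 := by exact_mod_cast hl0
      have harg : (↑(-2 * π * v * (n : ℝ)) : ℂ) * Complex.I =
          -(2 * π * Complex.I * n * ((l * v : ℝ) : ℂ) / l) := by
        push_cast
        rw [mul_div_assoc, mul_div_cancel_left₀ _ hlC]
        ring
      simp only [hf, rescale_apply, smul_eq_mul, harg]
    rw [hint, hsub, Complex.real_smul]
    push_cast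
    ring
  -- assemble: `Σ_k g(kl) = l⁻¹ Σ_n ∫ g e^{-2πi n t/l}`, then reindex `n ↦ -ν`
  rw [h1] at hP
  simp_rw [h2] at hP
  rw [tsum_mul_left] at hP
  have h3 : (∑' n : ℤ, ∫ t : ℝ, Complex.exp (-(2 * π * Complex.I * n * t / l)) * g t) =
      trace l g := by
    rw [trace, ← Equiv.tsum_eq (Equiv.neg ℤ)]
    refine tsum_congr fun ν => ?_
    refine integral_congr_ae (ae_of_all _ fun t => ?_)
    simp only [Equiv.neg_apply, Int.cast_neg]
    ring_nf
  rw [h3] at hP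
  rw [hP, ← mul_assoc, mul_inv_cancel₀ (by exact_mod_cast hl0), one_mul]

/-- **The closed-orbit atom, isolated.** For a Schwartz function `g` supported in the window
`(l/2, 3l/2)` around the period `l` (which contains no other multiple of `l`), the distributional
trace of the translation flow pairs with `g` to `l · g(l)`: on this window the trace IS the Dirac
term `l(γ) · δ_{l(γ)}` of the single closed orbit — an atom of weight `l ≠ 0`, carried by the
INFINITE-dimensional `H̄^0 = C^∞(ℝ/lℤ)` (contrast: a finite-dimensional flow carrier has a
continuous Lefschetz density and can carry no atom, `Literature.Barriers.RiemannHypothesis.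
FiniteCarrierNoOrbitAtoms`). [cite: Deninger2002, Thm 3.3] -/
theorem trace_eq_of_tsupport_subset {l : ℝ} (hl : 0 < l) (g : 𝓢(ℝ, ℂ))
    (hg : tsupport (g : ℝ → ℂ) ⊆ Ioo (l / 2) (3 * l / 2)) :
    trace l g = l * g l := by
  rw [trace_eq_tsum hl, tsum_eq_single 1]
  · simp
  · intro k hk
    apply image_eq_zero_of_notMem_tsupport
    intro hmem
    have h := hg hmem
    rcases lt_or_gt_of_ne hk with hk' | hk'
    · have hk0 : (k : ℝ) ≤ 0 := by exact_mod_cast (Int.lt_add_one_iff.mp (by omega) : k ≤ 0)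
      have : (k : ℝ) * l ≤ 0 := mul_nonpos_of_nonpos_of_nonneg hk0 hl.le
      linarith [h.1]
    · have hk2 : (2 : ℝ) ≤ k := by exact_mod_cast (show (2 : ℤ) ≤ k by omega)
      have : 2 * l ≤ (k : ℝ) * l := by nlinarith
      linarith [h.2]

/-- The case `l = 1`: `Σ_ν ∫ g(t) e^{2πiνt} dt = Σ_k g(k)` — the Poisson summation formula read as
the dynamical trace formula of the circle of length `1` (closed-orbit atoms `δ_k`, `k ≠ 0`, plus
`δ_0`). [cite: Deninger2002, Thm 3.3] -/
theorem trace_one_eq_tsum (g : 𝓢(ℝ, ℂ)) : trace 1 g = ∑' k : ℤ, g k := by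
  simpa using trace_eq_tsum one_pos g

end TranslationFlow

end Literature.Dynamics.Circle
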